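import Summits.HubbardSuperconductivity.HubbardSuperconductivity.Theorems.AnisotropyChordTransferFibre3N1RowReductions
import Summits.HubbardSuperconductivity.HubbardSuperconductivity.Theorems.AnisotropyChordTransferFibre3ManifoldA
import Summits.HubbardSuperconductivity.HubbardSuperconductivity.Theorems.AnisotropyChordTransferFibre3TtailBounds
import Summits.HubbardSuperconductivity.HubbardSuperconductivity.Theorems.AnisotropyChordTransferFibre3Delta3Bound
import Summits.HubbardSuperconductivity.HubbardSuperconductivity.Theorems.AnisotropyChordTransferFibre3Lam2Small
import Summits.HubbardSuperconductivity.HubbardSuperconductivity.Theorems.AnisotropyChordTransferFibre3Lam2LogBound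

/-!
# Route `AnisotropyChord` / H0 rotor rung, LEVEL 2 row `N₁` (PartN41-B §3): the scalar / named-momentum identities of the
ground profile

PORT PartN41-B (`…Fibre3N1Row`, theory-1 g22) §3 relates the profile scalars of the `N₁` row to the named sums:
* `gzeroNamed_holds : GzeroNamed L` — `G̃(0) = S₁/V`;
* `gapEquationS1_holds : 5 ≤ L → 0 ≤ Δ → Δ < 1 → GapEquationS1 L Δ` — `c_s S₁ = V − a(V − 1)` (from p1's
  `ManifoldA.manifold_dictionary` (v): `c_s G̃(0) = 1 − a + a/V`);
* `sNormNamed_holds : 5 ≤ L → 0 ≤ Δ → SNormNamed L Δ` — `‖s‖² = (c_s² S₂ + a²)/V` (Parseval `normSq_dft_sum` + `dft_sfun'`);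
* `tfunNamed_holds : 5 ≤ L → 0 ≤ Δ → TfunNamed L Δ` — `t(q) = (c_s² T(q) − 2a c_s g(q))/V` at the eight named momenta, `T = T10`
  on the axes and `T11` on the diagonals (`fsqFourier_holds`, `dft_sfun'`, and the lattice symmetries `gres_neg`, `gres_swap`,
  `gres_reflect`/`epsT_reflect` of the propagator to identify every `Σ_p g(p) g(p − q)` with `T10n`/`T11n`).
The `Δ`-range hypotheses are those of the manifold dictionary / `lam2_lt_two_eps1`; the cell evaluator only uses `0 < Δ < 1`.
Prover seat `hubbard-h0-rotor-p2` g4; helper for piece A = stmt-HubbardSuperconductivity-23918 of rung 19089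
(`--supports`, helper class).  Nothing here proves superconductivity in the Hubbard model; helper lemmas of ONE conditional
reduction (the GM₃ ∀L certificate, Level-2 row `N₁`); the rotor TARGET as originally worded stays FALSE (g15 verdict).
Mathlib + the tree only; no sorry.
-/

set_option linter.dupNamespace false
set_option autoImplicit false

noncomputable section

open scoped BigOperators

namespace Summit.HubbardSuperconductivity.HubbardSuperconductivity.Theorems.AnisotropyChord.Transfer.Fibre3

variable (L : ℕ) [NeZero L]

/-! ## `G̃(0)` and the gap equation in named form -/

/-- ★ **`GzeroNamed` holds**: `Gzero L λ = S1n L λ / V`. -/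
theorem gzeroNamed_holds : GzeroNamed L := by
  intro lam2
  rw [S1n_eq, ← Gres_zero_eq, Gres_zero_zero_eq_sum_erase]
  rfl

/-- ★ **`GapEquationS1` holds** on the physical range `0 ≤ Δ < 1` (`L ≥ 5`): `c_s S₁ = V − a(V − 1)`. -/
theorem gapEquationS1_holds (hL : 5 ≤ L) {Δ : ℝ} (hΔ0 : 0 ≤ Δ) (hΔ1 : Δ < 1) : GapEquationS1 L Δ := by
  intro lam2 f hf _
  have hV : (0 : ℝ) < (L : ℝ) ^ 2 := by
    have : (0 : ℝ) < L := by exact_mod_cast (show 0 < L by omega)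
    positivity
  have h5 := (ManifoldA.manifold_dictionary L hL hΔ0 hΔ1 hf).2.2.2.2.1
  rw [Gres_zero_eq] at h5
  have h6 : cS L Δ lam2 f * (∑ k : Tor L, gres L lam2 k)
      = (1 - Δ * f (K1 L) + Δ * f (K1 L) / (L : ℝ) ^ 2) * (L : ℝ) ^ 2 := by
    rw [← h5]; field_simp
  unfold aPar
  rw [S1n_eq, h6]
  field_simp
  ring

/-! ## `‖s‖²` by Parseval -/

/-- ★ **`SNormNamed` holds** (`L ≥ 5`, `0 ≤ Δ`): `Σ_r s(r)² = (c_s² S₂ + a²)/V`. -/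
theorem sNormNamed_holds (hL : 5 ≤ L) {Δ : ℝ} (hΔ0 : 0 ≤ Δ) : SNormNamed L Δ := by
  classical
  intro lam2 f hf _
  have hV : (0 : ℝ) < (L : ℝ) ^ 2 := by
    have : (0 : ℝ) < L := by exact_mod_cast (show 0 < L by omega)
    positivity
  have hl2 := lam2_lt_two_eps1 L hL hΔ0 hf
  have hP := normSq_dft_sum L (sfun' L Δ f)
  have hdft : ∀ q : Tor L, Complex.normSq (dft L (sfun' L Δ f) q)
      = (if q = 0 then (Δ * f (K1 L)) ^ 2 else cS L Δ lam2 f ^ 2 * gres L lam2 q ^ 2) := by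
    intro q
    rw [dft_sfun' L (by omega) hf.1 hl2 q, Complex.normSq_ofReal]
    unfold gres
    split_ifs <;> ring
  rw [Finset.sum_congr rfl fun q _ => hdft q, Finset.sum_ite, Finset.sum_const, Finset.filter_eq',
    if_pos (Finset.mem_univ _), Finset.card_singleton, one_smul, Finset.filter_ne', ← Finset.mul_sum] at hP
  have hS2 : ∑ q ∈ Finset.univ.erase (0 : Tor L), gres L lam2 q ^ 2 = S2n L lam2 := by
    rw [S2n_eq, ← Finset.add_sum_erase _ _ (Finset.mem_univ (0 : Tor L))]
    have : gres L lam2 0 = 0 := by unfold gres; simp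
    rw [this]; ring
  rw [hS2] at hP
  unfold sNormSq dPar
  rw [eq_div_iff hV.ne']
  linarith

/-! ## `t(q)` at the named momenta -/

/-- the dispersion is reflection symmetric: `ε(k₁, −k₂) = ε(k₁, k₂)`. [folklore] -/
theorem epsT_reflect (k : Tor L) : epsT L (k.1, -k.2) = epsT L k := by
  have e1 : (-k.2) = (((-(k.2.valMinAbs) : ℤ)) : ZMod L) := by simp [ZMod.coe_valMinAbs]
  have e2 : Real.cos (2 * Real.pi * (k.2.val : ℝ) / L) = Real.cos (2 * Real.pi * ((k.2.valMinAbs : ℤ) : ℝ) / L) := by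
    have h := cos_two_pi_val_intCast L (k.2.valMinAbs)
    rw [ZMod.coe_valMinAbs] at h
    exact h
  unfold epsT
  simp only
  rw [e1, cos_two_pi_val_intCast, e2]
  push_cast
  rw [show 2 * Real.pi * -((k.2.valMinAbs : ℤ) : ℝ) / L = -(2 * Real.pi * ((k.2.valMinAbs : ℤ) : ℝ) / L) by ring,
    Real.cos_neg]

/-- the propagator is reflection symmetric: `g(k₁, −k₂) = g(k₁, k₂)`. [folklore] -/
theorem gres_reflect (lam2 : ℝ) (k : Tor L) : gres L lam2 (k.1, -k.2) = gres L lam2 k := by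
  unfold gres
  have hz : ((k.1, -k.2) : Tor L) = 0 ↔ k = 0 := by
    constructor
    · intro h
      have ha := congrArg Prod.fst h; have hb := congrArg Prod.snd h
      simp only [Prod.fst_zero, Prod.snd_zero, neg_eq_zero] at ha hb
      exact Prod.ext ha hb
    · intro h; rw [h]; simp
  simp only [hz, epsT_reflect]

/-- the two-propagator convolution at an axis / diagonal momentum is `T10n` / `T11n`. [folklore] -/
theorem conv_named (lam2 : ℝ) :
    (∀ q ∈ [ex L, -ex L, ey L, -ey L], ∑ p : Tor L, gres L lam2 p * gres L lam2 (p - q) = T10n L lam2) ∧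
    (∀ q ∈ [ex L + ey L, ex L - ey L, -ex L + ey L, -ex L - ey L],
      ∑ p : Tor L, gres L lam2 p * gres L lam2 (p - q) = T11n L lam2) := by
  -- the named sums unfolded
  have hT10 : T10n L lam2 = ∑ p : Tor L, gres L lam2 p * gres L lam2 (p + ex L) := by
    unfold T10n B1.torSum
    refine Finset.sum_congr rfl fun p _ => ?_
    rw [Fin.prod_univ_two]
    simp [B1.toTor, Prod.mk_zero_zero, ex]
  have hT11 : T11n L lam2 = ∑ p : Tor L, gres L lam2 p * gres L lam2 (p + (ex L + ey L)) := by
    unfold T11n B1.torSum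
    refine Finset.sum_congr rfl fun p _ => ?_
    rw [Fin.prod_univ_two]
    simp [B1.toTor, Prod.mk_zero_zero, ex, ey, Prod.mk_add_mk]
  -- generic tools: shift by `c`, negate, swap, reflect
  have shift : ∀ c : Tor L, ∑ p : Tor L, gres L lam2 p * gres L lam2 (p - c)
      = ∑ p : Tor L, gres L lam2 (p + c) * gres L lam2 p := by
    intro c
    refine (Fintype.sum_equiv (Equiv.addRight c) _ _ fun p => ?_).symm
    simp
  have comm : ∀ c : Tor L, ∑ p : Tor L, gres L lam2 (p + c) * gres L lam2 p
      = ∑ p : Tor L, gres L lam2 p * gres L lam2 (p + c) := fun c => Finset.sum_congr rfl fun p _ => mul_comm _ _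
  have negsum : ∀ c : Tor L, ∑ p : Tor L, gres L lam2 p * gres L lam2 (p + -c)
      = ∑ p : Tor L, gres L lam2 p * gres L lam2 (p + c) := by
    intro c
    refine Fintype.sum_equiv (Equiv.neg (Tor L)) _ _ fun p => ?_
    simp only [Equiv.neg_apply]
    rw [B1.gres_neg, show -p + c = -(p + -c) by abel, B1.gres_neg]
  have swapsum : ∀ c : Tor L, ∑ p : Tor L, gres L lam2 p * gres L lam2 (p + c)
      = ∑ p : Tor L, gres L lam2 p * gres L lam2 (p + (c.2, c.1)) := by
    intro c
    refine Fintype.sum_equiv (Equiv.prodComm (ZMod L) (ZMod L)) _ _ fun p => ?_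
    simp only [Equiv.prodComm_apply, Prod.swap]
    rw [show ((p.2, p.1) : Tor L) = ((p.2, p.1) : Tor L) from rfl, gres_swap]
    have : ((p.2, p.1) : Tor L) + (c.2, c.1) = ((p + c).2, (p + c).1) := by ext <;> simp [add_comm]
    rw [this, gres_swap]
  have reflsum : ∀ c : Tor L, ∑ p : Tor L, gres L lam2 p * gres L lam2 (p + c)
      = ∑ p : Tor L, gres L lam2 p * gres L lam2 (p + (c.1, -c.2)) := by
    intro c
    have hinv : Function.Involutive (fun p : Tor L => ((p.1, -p.2) : Tor L)) := fun p => by simp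
    refine Fintype.sum_equiv (hinv.toPerm _) _ _ fun p => ?_
    simp only [Function.Involutive.coe_toPerm]
    rw [gres_reflect]
    have : ((p.1, -p.2) : Tor L) + (c.1, -c.2) = ((p + c).1, -(p + c).2) := by ext <;> simp; abel
    rw [this, gres_reflect]
  -- the vector identities
  have vswap_ey : (((ey L).2, (ey L).1) : Tor L) = ex L := by unfold ex ey; rfl
  have vrefl_d : (((ex L - ey L).1, -(ex L - ey L).2) : Tor L) = ex L + ey L := by
    unfold ex ey; ext <;> simp
  have vrefl_a : (((-ex L + ey L).1, -(-ex L + ey L).2) : Tor L) = -(ex L + ey L) := by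
    unfold ex ey; ext <;> simp
  have vneg_dd : (-ex L - ey L : Tor L) = -(ex L + ey L) := by abel
  constructor
  · intro q hq
    simp only [List.mem_cons, List.not_mem_nil, or_false] at hq
    rw [shift, comm]
    rcases hq with rfl | rfl | rfl | rfl
    · rw [← hT10]
    · rw [negsum, ← hT10]
    · rw [swapsum, vswap_ey, ← hT10]
    · rw [negsum, swapsum, vswap_ey, ← hT10]
  · intro q hq
    simp only [List.mem_cons, List.not_mem_nil, or_false] at hq
    rw [shift, comm]
    rcases hq with rfl | rfl | rfl | rfl
    · rw [← hT11]
    · rw [reflsum, vrefl_d, ← hT11]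
    · rw [reflsum, vrefl_a, negsum, ← hT11]
    · rw [vneg_dd, negsum, ← hT11]

/-- ★ **`TfunNamed` holds** (`L ≥ 5`, `0 ≤ Δ`): `t(q) = (c_s² T(q) − 2a c_s g(q))/V` at the named momenta. -/
theorem tfunNamed_holds (hL : 5 ≤ L) {Δ : ℝ} (hΔ0 : 0 ≤ Δ) : TfunNamed L Δ := by
  classical
  intro lam2 f hf _
  have hL3 : 3 ≤ L := by omega
  have hV : (0 : ℝ) < (L : ℝ) ^ 2 := by
    have : (0 : ℝ) < L := by exact_mod_cast (show 0 < L by omega)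
    positivity
  have hl2 := lam2_lt_two_eps1 L hL hΔ0 hf
  -- `t(q)` as a real convolution of `ŝ`
  set shat : Tor L → ℝ := fun q => if q = 0 then -(Δ * f (K1 L)) else cS L Δ lam2 f * gres L lam2 q with hshat
  have hdft : ∀ q : Tor L, dft L (sfun' L Δ f) q = ((shat q : ℝ) : ℂ) := by
    intro q
    rw [dft_sfun' L hL3 hf.1 hl2 q]
    simp only [hshat]
    unfold gres
    split_ifs <;> push_cast <;> ring
  have ht : ∀ q : Tor L, tfun L Δ f q = (∑ p : Tor L, shat p * shat (q - p)) / (L : ℝ) ^ 2 := by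
    intro q
    unfold tfun
    rw [fsqFourier_holds L (sfun' L Δ f) q]
    simp only [hdft]
    have : (∑ p : Tor L, ((shat p : ℝ) : ℂ) * ((shat (q - p) : ℝ) : ℂ)) / ((L : ℂ) ^ 2)
        = ((((∑ p : Tor L, shat p * shat (q - p)) / (L : ℝ) ^ 2 : ℝ)) : ℂ) := by
      push_cast; rfl
    rw [this, Complex.ofReal_re]
  -- `ŝ(p) = −a·[p = 0] + c_s g(p)` since `g(0) = 0`
  have hg0 : gres L lam2 0 = 0 := by unfold gres; simp
  have hs : ∀ p : Tor L, shat p = (if p = 0 then -(Δ * f (K1 L)) else 0) + cS L Δ lam2 f * gres L lam2 p := by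
    intro p
    simp only [hshat]
    split_ifs with h
    · rw [h, hg0]; ring
    · ring
  -- the convolution of `ŝ` for `q ≠ 0`
  have hconv : ∀ q : Tor L, q ≠ 0 → ∑ p : Tor L, shat p * shat (q - p)
      = cS L Δ lam2 f ^ 2 * (∑ p : Tor L, gres L lam2 p * gres L lam2 (p - q))
        - 2 * (Δ * f (K1 L)) * cS L Δ lam2 f * gres L lam2 q := by
    intro q hq
    have e : ∀ p : Tor L, shat p * shat (q - p)
        = cS L Δ lam2 f ^ 2 * (gres L lam2 p * gres L lam2 (q - p))
          + (if p = 0 then -(Δ * f (K1 L)) * (cS L Δ lam2 f * gres L lam2 q) else 0)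
          + (if p = q then -(Δ * f (K1 L)) * (cS L Δ lam2 f * gres L lam2 q) else 0) := by
      intro p
      rw [hs p, hs (q - p)]
      by_cases h0 : p = 0
      · subst h0
        have hq0 : ¬ (q - 0 : Tor L) = 0 := by simpa using hq
        rw [if_pos rfl, if_neg hq0, if_pos rfl, if_neg (Ne.symm hq), hg0, sub_zero]; ring
      · by_cases hpq : p = q
        · subst hpq
          rw [if_neg h0, sub_self, if_pos rfl, if_neg h0, if_pos rfl, hg0]; ring
        · have : ¬ (q - p = 0) := fun h => hpq (by rw [sub_eq_zero] at h; exact h.symm)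
          rw [if_neg h0, if_neg this, if_neg h0, if_neg hpq]; ring
    rw [Finset.sum_congr rfl fun p _ => e p, Finset.sum_add_distrib, Finset.sum_add_distrib,
      Finset.sum_ite_eq' Finset.univ (0 : Tor L), Finset.sum_ite_eq' Finset.univ q, ← Finset.mul_sum]
    simp only [Finset.mem_univ, if_true]
    -- `Σ_p g(p) g(q − p) = Σ_p g(p) g(p − q)` (`g` even)
    have hev : ∑ p : Tor L, gres L lam2 p * gres L lam2 (q - p) = ∑ p : Tor L, gres L lam2 p * gres L lam2 (p - q) := by
      refine Finset.sum_congr rfl fun p _ => ?_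
      rw [← B1.gres_neg L lam2 (q - p), neg_sub]
    rw [hev]; ring
  obtain ⟨c10, c11⟩ := conv_named L lam2
  have hq_ne : ∀ q : Tor L, q ∈ [ex L, -ex L, ey L, -ey L] ∨ q ∈ [ex L + ey L, ex L - ey L, -ex L + ey L, -ex L - ey L] →
      q ≠ 0 := by
    intro q hq h0
    have hL1 : (1 : ZMod L) ≠ 0 := by
      haveI : Fact (1 < L) := ⟨by omega⟩
      exact one_ne_zero
    rcases hq with hq | hq <;> simp only [List.mem_cons, List.not_mem_nil, or_false] at hq <;>
      rcases hq with rfl | rfl | rfl | rfl <;>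
      exact hL1 (by simpa [ex, ey, Prod.ext_iff] using h0)
  unfold aPar
  constructor
  · intro q hq
    rw [ht q, hconv q (hq_ne q (Or.inl hq)), c10 q hq]
  · intro q hq
    rw [ht q, hconv q (hq_ne q (Or.inr hq)), c11 q hq]

end Summit.HubbardSuperconductivity.HubbardSuperconductivity.Theorems.AnisotropyChord.Transfer.Fibre3

end
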